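import Literature.NumberTheory.EllipticCurves.Kobayashi2003.SignedKatoDivisibility
import Literature.NumberTheory.EllipticCurves.Kato2004.EulerSystemClasses
import Literature.NumberTheory.EllipticCurves.KatoFineSelmerDual
import HarnessLib

/-!
# Kobayashi 2003, Thm. 6.2 (6.13)/(6.14) + Thm. 6.3 + Thm. 7.3 i) (7.21) at the TRIVIAL character
# (`F_∞ = ℚ_∞`), with Kato 2004 Thm. 12.6 / Ex. 13.3 (the zeta submodule is spanned by GENUINE
# Euler-system classes) and the image sentence «`Col^±(z_Kato) = L_p^±(E, X)`» read on IDEALS at every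
# height-one prime — ONE hypothesis structure (`SignedColemanKatoData`) on the tree's PINNED
# `𝐇¹_Γ(T_pW)` / `X^ε(E/ℚ_∞)` / `X₀(E/ℚ_∞)` + ONE construction fact (`thm62_63_73_signedColemanKato_zeta`)

Topic `NumberTheory/EllipticCurves`, sub-directory `Kobayashi2003` (namespace = path). Filed by cell
`bsd-ssimc` (HOME `run/shared/lean/pub/bsd-ssimc/`), WIDTH-LEVER lane B = seat `bsd-ssimc-k3-c4x` g0
(prover), rung K3 of `BirchSwinnertonDyer`, route `SignedLowerHalves`, crux item
stmt-BirchSwinnertonDyer-19002 `KobayashiMainConjectureSmallImage` (registered stub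
`stub_saturationSmallImage`). HONEST FRAMING (cell bsd-ssimc): the programme assembles the
Birch–Swinnerton-Dyer formula for analytic-rank `≤ 1` curves STRICTLY from published theorems and
TYPES the remainder; BSD is not proved by any of this; nothing is booked. THIS FILE: one hypothesis
STRUCTURE whose fields are printed statements RELATIVE TO PINNED OBJECTS of the tree, and one named
CONSTRUCTION fact (`def … : Prop`, D-0014; nothing asserted, no `_holds`; net debt +1) saying the
structure is inhabited. It is the `η = 1` companion of the ACCEPTED `η = ω^{(p−1)/2}` file
`Kobayashi2003/EtaColemanPoitouTateSequences.lean` (cell `bsd-potss`, structure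
`EtaColemanPoitouTateData` + fact `thm62_63_73_etaColemanPoitouTate`), whose «NOT here» list names
exactly this component («NO statement for `η = 1` ((6.14), the `Δ`-component): the tree's `η = 1`
currency is `Kobayashi2003.SignedSelmerDualData` over `ℚ_∞`»), WITH the zeta-side clauses shaped
word for word as in the ACCEPTED Kato facts `Kato2004.exists_divisibilityInputs_fineQuotient_zeta`
(cell `bsd-smallim`, rung K6) and `Kato2004.exists_multDivisibilityInputs_fine` (cell `bsd-stepL`):
the span clause (Thm. 12.6 + Ex. 13.3) and the localized image clause (p. 280 ∕ here Kobayashi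
Thm. 6.3). No instance, no notation, no attribute is declared or removed; no theorem is claimed from
print beyond the conjunction below.

## Why this file (the consumer)

Rung K6 kernel-checked the Kato `μ`-TRANSFER WITHOUT BIG IMAGE at a good ORDINARY prime
(`X10.mu_eq_zero_of_fine`: `E[p]` irreducible, `ρ̄` not onto, one unit coefficient of `L_p(E)` ⟹
`μ(X(E/ℚ_∞)) = 0`, modulo `exists_divisibilityInputs_fineQuotient_zeta`), and cell `bsd-stepL` ran
the same chain at `p ∥ N` (`MultMu.mu_eq_zero_of_multFine`, modulo `exists_multDivisibilityInputs_fine`);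
the core of the chain is reduction-free (`CoreAssembly.coreOdd_anyReduction_holds`, p486975). Crux 4 of
route `SignedLowerHalves` lives at a good SUPERSINGULAR prime with `a_p = 0` and NON-surjective image,
where Kobayashi's Thm. 4.1 gives `Char X^± ⊇ (pⁿ L_p^±)` with `n = 0` ONLY for surjective `ρ_{E,p^∞}`
(Kato (12.5.2)); lane A of the cell (seat `k3-c4`) reduced the registered stub
`stub_saturationSmallImage` to «`μ(X^ε(E/ℚ_∞)) = 0`» (`Theorems.kobayashiMainConjecture_of_mu_eq_zero_of_lowerDivisibility`).
The present fact is the `±` input that lets the K6 chain run at such a prime: with it,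
`Summits/BirchSwinnertonDyer/BirchSwinnertonDyer/Theorems/SignedLowerHalvesKobayashiMainConjectureSmallImageSignedMuTransfer.lean`
(this seat) proves «`μ(L_p^ε(E)) = 0 ⟹ μ(X^ε(E/ℚ_∞)) = 0`» CLASS-WIDE at non-surjective image and
hence `stub_saturationSmallImage` modulo published facts and that one analytic rider.

## Source, verbatim (S. Kobayashi, *Iwasawa theory for elliptic curves at supersingular primes*,
## Invent. Math. 152 (2003) 1–36 [Kobayashi2003]; held copy `paper:doi-10-1007-s00222-002-0265-4`,
## page = file number, read by this seat 2026-08-27, pp. 2, 5–13)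

Standing (p. 1–2): "Let `p` be an odd prime. Let `F = ℚ` and `F_∞/F` the cyclotomic `ℤ_p`-extension
with `n`-th layer `F_n`. … let `E` be an elliptic curve over `ℚ` with good supersingular reduction at
`p`. Suppose `a_p = 0`." §2 (pp. 4–5): `K_n = ℚ(ζ_{p^{n+1}})`, `K_∞ = ℚ(μ_{p^∞})`, `G_∞ = Gal(K_∞/ℚ)`,
`Λ = ℤ_p[[G_∞]]`; p. 5: "**Definition 2.1.** The even (odd) Selmer group is defined by `Sel^±(E/K_n) :=
Ker(H¹(K_n, E[p^∞]) → ∏_v H¹(K_{n,v}, E[p^∞])/E^±(K_{n,v}) ⊗ ℚ_p/ℤ_p)` and `Sel^±(E/K_∞) := lim→_n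
Sel^±(E/K_n)`. Following Kurihara [9], we also define the zero Selmer group by `Sel⁰(E/K_n) :=
Ker(H¹(K_n, E[p^∞]) → ∏_v H¹(K_{n,v}, E[p^∞]))` and `Sel⁰(E/K_∞) := lim→_n Sel⁰(E/K_n)`. We denote
the Pontryagin dual of Selmer groups by "X"." §4 (p. 8): "By Theorem 2.2, `X^±(E/K_∞)^η` is a torsion
`ℤ_p[[Γ]]`-module. **Conjecture (Even main conjecture).** For every `η`, we have `Char(X⁺(E/K_∞)^η) =
(L_p⁺(E, η, X))`. **Conjecture (Odd main conjecture).** If `η` is trivial, we have `Char(X⁻(E/K_∞)^Δ)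
= (L_p⁻(E, X))`." p. 7: "**Theorem 3.2 (Pollack).** There exist power series `L_p^±(E, η, X)` in
`ℤ_p[[X]]` … We remark that our sign of Pollack's `p`-adic `L`-function is opposite to that in [18]",
(3.4)/(3.5): `L_p^±(E, η, ζ − 1)` interpolate `L(E, ψ̄, 1)/Ω_E^δ` (NÉRON periods). p. 9: "**Theorem 5.1
(Kato [7]).** … iii) If `T/pT` is irreducible as a two dimensional representation of `Gal(ℚ̄/ℚ)` over
`𝔽_p`, then `𝐇¹(T)` is a free `Λ`-module of rank 1." "**Theorem 5.2 (Kato [7]).** i) There exist two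
systems of elements `z^± = (z_n^±)_n ∈ 𝐇¹(V)` … iv) Let `Z(T)` be the `Λ`-submodule of `𝐇¹(V)`
generated by `z⁺` and `z⁻`. Suppose that `T/pT` is irreducible … Then `Z(T) ⊆ 𝐇¹(T)` in `𝐇¹(V)`. …
*Proof.* See Kato [7], Theorem 12.5. For iv), we need Theorem 12.6 of Kato [7]. See also the argument
in Sect. 13.14 of [7]. We also use the fact that the Néron period differs from the canonical period by
a `p`-adic unit (cf. Greenberg-Vatsal [3])." p. 10: "**Remark 5.3.** i) When `E` has supersingular
reduction at `p`, the condition in Theorem 5.1 iii) and 5.2 iv) is satisfied." "**Definition 6.1.** We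
define `H¹_±(k_n, T)` as the exact annihilator with respect to the Tate pairing … of the subgroup
`E^±(k_n) ⊗ ℚ_p/ℤ_p ⊆ H¹(k_n, V/T)`. We let `H¹_Iw(T) = lim←_n H¹(k_n, T)` and `H¹_{Iw,±}(T) = lim←_n
H¹_±(k_n, T)`." p. 11: "**Theorem 6.2.** The even (odd) Coleman maps induce isomorphisms … Taking the
limit of the above isomorphisms, we have `Col⁺ : H¹_Iw(T)/H¹_{Iw,+}(T) ≃ Λ` (6.13), `Col⁻ :
H¹_Iw(T)^Δ/H¹_{Iw,−}(T)^Δ ≃ Λ^Δ` (6.14), `Col⁻ : H¹_Iw(T)^η/H¹_{Iw,−}(T)^η ≃ I^η` for `η ≠ 1` (6.15)."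
"**Theorem 6.3.** Let `z^± ∈ 𝐇¹(T)` be Kato's zeta element in Theorem 5.2. By the localization map,
we regard `z^±` as an element of `H¹_Iw(T)`. Then, the image of Kato's zeta element by the even (odd)
Coleman map is Pollack's `p`-adic `L`-function: `Col^±(z_{η(−1)})^{ε_η} = η(−1) L_p^±(E, η, X) ε_η`."
p. 12: "We have `E(K_{n,v}) ⊗ ℚ_p/ℤ_p = 0` for the places `v` not lying above `p`. … from the
Tate-Poitou exact sequence, we have … `H¹(G_{n,S}, T) → H¹(k_n, T)/H¹_±(k_n, T) → X^±(E/K_n) →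
X⁰(E/K_n) → 0` (7.17) … Taking the limit … `𝐇¹_{/S}(T) → H¹_Iw(T)/H¹_{Iw,±}(T) → X^±(E/K_∞) →
X⁰(E/K_∞) → 0` (7.20). **Proposition 7.1 (Kurihara).** i) The canonical mapping `𝐇¹(T) → 𝐇¹_{/S}(T)`
is an isomorphism. ii) `𝐇²(T)` is isomorphic to `X⁰(E/K_∞)` as `Λ`-module." p. 13: "**Theorem 7.3.**
i) We have an exact sequence `0 → 𝐇¹(T) → H¹_Iw(T)/H¹_{Iw,±}(T) → X^±(E/K_∞) → X⁰(E/K_∞) → 0` (7.21).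
ii) The even (odd) Selmer group `Sel^±(E/K_∞)` is `Λ`-cotorsion. *Proof.* The exact sequence is nothing
but (7.20) except for the injectivity … Since `𝐇¹(T)` is a free `Λ`-module of rank 1 (cf. Theorem 5.1
iii)), this morphism is injective if and only if it is a non-zero map. Hence i) follows from Theorem
6.3 and Rohrlich's theorem [20] …" "**Theorem 7.4.** … *Proof.* By Theorem 6.2, 6.3 and (7.21), we
have three exact sequences `0 → 𝐇¹(T)^η/Z(T)^η → Λ^η/(L_p⁺(E, η, X)) → X⁺(E/K_∞)^η → X⁰(E/K_∞)^η → 0`,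
`0 → 𝐇¹(T)^Δ/Z(T)^Δ → Λ^Δ/(L_p⁻(E, X)) → X⁻(E/K_∞)^Δ → X⁰(E/K_∞)^Δ → 0`, … Theorem 4.1 also follows
from Theorem 5.2 iii), iv), v) and the exact sequences in the proof of Theorem 7.4."
K. Kato, Astérisque 295 (2004) [Kato2004Asterisque], Thm. 12.6 (p. 222): "Let `Z` be the `Λ`-submodule
of `𝐇¹(V_{O_λ}(f))` generated by the following elements (1) `(_{c,d}z^{(p)}_{p^n}(f, k, j, a(A),
prime(pA)))_{n≥1} ∈ 𝐇¹(T)` … (2) `(_{c,d}z^{(p)}_{p^n}(f, k, j, α, prime(pN)))_{n≥1} ∈ 𝐇¹(T)` … Then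
`Z ⊂ Z(f,T)` and `Z(f,T)/Z` is a finite group", with Ex. 13.3 (p. 225): "Then `(z_m)_m` is an Euler
system for `(T, F_λ, Σ)`" — quoted in full in `Kato2004/EulerSystemClasses.lean`.

## Transcription — what the structure says, field by field, and the reading flags (for the referee)

Frame: `p` odd; `W/ℚ` globally minimal with good reduction at `p` and `a_p = 0` (so supersingular; the
structure facts `ContinuousSMul ℤ_[p] (T_pW)`, `Module.Free/Finite ℤ_[p] (T_pW)` are instance BINDERS,
discharged Summits-side by `TateModule.continuousSMul_padicInt`, `module_free_tateModule_holds`,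
`module_finite_tateModule_holds`, exactly as in `Kato2004.exists_divisibilityInputs_fineQuotient_zeta`);
`f` a newform of `W` (`IsNewformOf W f`, any level — the input of the tree's Pollack facts); `ϖ ∈ ℚ` the
period ratio `ϖ·Ω_E = Ω⁺_f` (so Kobayashi's NÉRON-normalised `L_p^±(E, X)` ((3.4)–(3.6)) is
`ϖ · L` for the tree's `Ω⁺_f`-normalised `L`, `IsSignedPAdicLFunction f p ε L` — the SAME spelling
as the tree's `Summit.….KobayashiMainConjecture W p ε`, «`ι g = C(ϖ) · ι L^ε`», and as clause 4 of
`exists_multDivisibilityInputs_fine`; `ϖ` is carried EXPLICITLY, so no period-unit statement is used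
or needed here); `κ` the cyclotomic `ℤ_p`-extension of `ℚ` with topological generator `γ` MATCHING
THE CYCLOTOMIC VARIABLE (`IsCyclotomicVariable p γ`: Kobayashi §3 p. 5 "we identify `γ` with
`1 + X`"; the tree's Mazur–Tate elements and hence `IsSignedPAdicLFunction` are written in that
variable — the same triple of hypotheses as `thm41_signedCharIdeal_divisibility`); a sign `ε`
(`ε = 1` = Kobayashi's even/plus, `ε = −1` = odd/minus, as in `SignedSelmerDualData` and
`IsSignedPAdicLFunction`); and the PINNED `I : Kato2004.IwasawaH1Data W p κ γ` (`I.H = 𝐇¹_Γ(T_pW)` =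
the `Δ`-trivial component `𝐇¹(T)^Δ` of Kobayashi's `𝐇¹(T)`, `T = T_pE`, READING of
`Kato2004/IwasawaCohomology.lean`). Then `SignedColemanKatoData W p f ϖ κ γ ε I` records:
* `col : I.H →ₗ[Λ] Λ` — «`Col^ε ∘ loc_p` on the `Δ`-trivial component»: the first arrow of (7.21)
  (sign `ε`) composed with the isomorphism (6.13) (`ε = +`: `H¹_Iw(T)/H¹_{Iw,+}(T) ≃ Λ`, whose
  `Δ`-trivial component is `≃ Λ^Δ = ℤ_p[[X]]`) resp. (6.14) (`ε = −`: `H¹_Iw(T)^Δ/H¹_{Iw,−}(T)^Δ ≃ Λ^Δ`);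
  `col_injective` = Thm. 7.3 i) (printed proof: Thm. 5.1 iii) — satisfied by Remark 5.3 i) —, Thm.
  6.3 and Rohrlich).
* `Z : Submodule Λ I.H` with `zeta_le_span` — «Kato's Thm. 12.6 submodule `Z`, projected to the
  `Δ`-trivial component»: `Z ≤ span{s | IsEulerSystemClass W p κ γ I s}`, VERBATIM the span clause of
  `Kato2004.exists_divisibilityInputs_fineQuotient_zeta` (Thm. 12.6 + Ex. 13.3: each generator is the
  `p`-power line of a GENUINE integral Euler system; the projection `e₀·(z_{p^{n+1}})_n ↔
  (p−1)⁻¹·(Cor z_{p^{n+1}})_n` as documented there). No hypothesis on the reduction at `p` is involved.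
* `image_zeta_localized` — Thm. 6.3 (sign `ε`, `η = 1`, `η(−1) = 1`: «`Col^ε(z₊)^Δ = L_p^ε(E, X)`»)
  read on IDEALS at every height-one prime `𝔭` of `Λ`, under `Irr(E[p])` (Thm. 5.2 iv) / Remark 5.3 i):
  `Z(T) ⊆ 𝐇¹(T)`): for `L` with `IsSignedPAdicLFunction f p ε L` and `G₁ ∈ Λ` with `ι G₁ = C(ϖ)·ι L`
  (= Kobayashi's NÉRON-normalised `L_p^ε(E, X) ∈ ℤ_p[[X]]`, Thm. 3.2), SOME `s ∉ 𝔭` has `s·G₁ ∈ col(Z)`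
  and `s·col(z) ∈ (G₁)` for all `z ∈ Z` — i.e. the ideals `col(Z)` and `(L_p^ε)` agree after
  localisation at `𝔭`. WHY THIS SHAPE (and not «`col z = L_p^ε`» for a named `z`): exactly as in the
  two Kato siblings (`DivisibilityInputs.image_zeta_localized`, clause 4 of
  `exists_multDivisibilityInputs_fine`) — Kato's `Z` (Thm. 12.6) has FINITE INDEX in `Z(f,T) =`
  Kobayashi's `Z(T) = Λz⁺ + Λz⁻` (Thm. 5.2 iv), so `Z_𝔭 = Z(T)_𝔭` at every height-one `𝔭` (a finite
  `Λ`-module is supported at the maximal ideal only; at `𝔭 = (p)` take `s` a power of `X ∉ (p)`), and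
  on the `Δ`-trivial component `col(Z(T)) = Λ·L_p^ε(E, X)`: `col(z₊) = L_p^ε(E, X)` by Thm. 6.3 with
  `η = 1`, while `col(ε₁z₋) = 0` since by Thm. 5.2 i) the dual-exponential values of `z⁻_n` vanish at
  every character `ψ` of `G_n` with `ψ(−1) = 1` ("`δ = 1` if `ψ(−1)` is equal to the sign of `z_n^±`,
  otherwise, `δ = 0`", p. 9), i.e. at every character of the `Δ`-trivial quotient, and `Col^ε` is
  determined by those values (§8.7). Units of `ℤ_p` (the Néron/canonical period unit of Thm. 5.2's
  proof, the sign conventions) are absorbed by the ideal-level statement with slack `s`.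
  Flag for the referee: `Kob03-63-eta1-ideal-localized` (reading, not a gap).
* `exact` — (7.21), sign `ε`, `Δ`-trivial component, with (6.13)/(6.14) composed in: for EVERY
  Pontryagin-dual datum `D` of `Sel^ε(E/ℚ_∞)` (`SignedSelmerDualData W κ γ ε`, Def. 1.1 — exists and is
  unique up to `Λ`-isomorphism by the tree theorems of `SignedSelmerDualExistsProofs` /
  `…UniquenessProofs`) and EVERY dual datum `Y` of the fine Selmer group `Sel₀(ℚ_∞, E[p^∞])`
  (`WeierstrassCurve.FineSelmerDualData W κ γ`), SOME `Λ`-linear `j : Λ → D.X`, `k : D.X → Y.X` with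
  `I.H →^{col} Λ →ʲ D.X →ᵏ Y.X → 0` exact («dual of the restriction to `𝔭`, through `Col^ε`», «dual of
  the inclusion `Sel⁰ ⊂ Sel^ε`»). The maps are existential: the printed deductions (Thm. 7.3 ii),
  Thm. 7.4, Thm. 4.1) use exactness only. Flag `Kob03-721-eta1-maps-existential` (as the `η`-sibling's
  `Kob03-721-eta-maps-existential`).
READING FLAGS. `Kob03-eta1-Ftower` (the `η`-sibling's `Kob03-Thm41-eta1-Ftower`, inherited from
`thm41_signedCharIdeal_divisibility` / `thm12_signedSelmerDual_finite_torsion`): Thm. 6.2/6.3/7.3 are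
PRINTED for `K_∞ = ℚ(μ_{p^∞})` with `Δ`-components; the `Δ`-trivial component is the `F_∞ = ℚ_∞`
object of the Introduction (restriction `H¹(F_n, E[p^∞]) → H¹(K_n, E[p^∞])^Δ` is an isomorphism,
`p ∤ #Δ`; `E^±(K_{n,v})^Δ = E^±(F_{n,p})`; `Δ`-invariants are exact) — the identification under which
Kobayashi states Thm. 1.2 = Thm. 2.2 and Thm. 1.3 = Thm. 4.1 for `F = ℚ`, and under which the tree's
`SignedSelmerDualData` (Def. 1.1 over `F_n`), `FineSelmerDualData` («`X⁰(E/K_∞)^Δ = X₀(E/ℚ_∞) =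
Hom(Sel₀(ℚ_∞, E[p^∞]), ℚ/ℤ)`»: Def. 2.1's `Sel⁰` = everywhere-locally-trivial classes = Kim's
`p`-strict fine Selmer group since `E(K_{n,v}) ⊗ ℚ_p/ℤ_p = 0` for `v ∤ p`, p. 12; the SAME reading as
`Kato2004.exists_divisibilityInputs_fineQuotient` and the `η`-sibling's `Kob03-eta-twist-currency`)
and `IwasawaH1Data` (`𝐇¹(T)^Δ = 𝐇¹_Γ(T_pW)`, §12.2/§13.8 of Kato as read in
`Kato2004/IwasawaCohomology.lean`) are the pinned ends. NOT formalised in the tree; the fields are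
stated directly on the `ℚ_∞`-objects. Everything recorded is implied by, never stronger than, the print.

## What is NOT here (and why)

* NO Coleman map on LOCAL objects ((6.10)–(6.12), Def. 6.1, Honda theory §8), no `exp*`, no Thm. 5.2
  i) as a value statement, no Thm. 6.2 surjectivity as a separate field (it is used only inside
  `exact`, to write the local term of (7.21) as `Λ`), no Cor. 7.2 / Prop. 7.1 ii) (the fine dual is
  torsion: the sibling fact `KatoFineSelmerDualTorsion`), no Thm. 1.2/2.2 (the named fact
  `thm12_signedSelmerDual_finite_torsion`), no Thm. 4.1 (the named fact
  `thm41_signedCharIdeal_divisibility`); no components `η ≠ 1` (the `η`-sibling file); no `_holds`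
  (Kato's Euler system and explicit reciprocity law, Perrin-Riou/Kobayashi Coleman maps, Poitou–Tate
  along the tower: none of it is in Mathlib; size XL).
* NO main [C] (Kobayashi p. 2 / §4) is asserted; the Summits-side typed missing input for `(E, p, ε)`
  stays what it is. (Docstring convention of the sibling files: the source's C-word is written `[C]`
  in declaration docstrings; this module docstring carries the unaltered quotations.)

References: [Kobayashi2003] Def. 1.1 (p. 2), §2 Def. 2.1, Thm. 2.2 (p. 5), §3 p. 5, Thm. 3.1–3.2 and
(3.2)–(3.7) (pp. 6–7), §4 (p. 8), Thm. 5.1, Thm. 5.2, Remark 5.3 (pp. 9–10), Def. 6.1 (p. 10), Thm. 6.2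
(6.13)–(6.15), Thm. 6.3 (p. 11), (7.16)–(7.20), Prop. 7.1 (p. 12), Cor. 7.2, Thm. 7.3 (7.21), Thm. 7.4
and its proof (p. 13), §8.7 (pp. 25–26); [Kato2004Asterisque] §12.2 (p. 220), Thm. 12.4–12.6
(pp. 221–222), Ex. 13.3 (p. 225), §13.8 (p. 228), (14.9.3) (p. 240), §17.13 (pp. 279–280);
[GreenbergVatsal2000] §3 (period unit; used by Kobayashi in the proof of Thm. 5.2 iv));
[Rohrlich1984] (used in the printed proof of Thm. 7.3 i)); tree: `Kobayashi2003/{SignedSelmer,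
SignedKatoDivisibility, EtaColemanPoitouTateSequences}.lean`, `Kato2004/{IwasawaCohomology,
EulerSystemClasses, DivisibilityInputs, DivisibilityInputsFine, DivisibilityInputsMultiplicativeFine}.lean`,
`KatoFineSelmerDual.lean`.
-/

noncomputable section

open scoped MatrixGroups ModularForm

open CongruenceSubgroup WeierstrassCurve Field Literature.NumberTheory.EllipticCurves
  Literature.NumberTheory.EllipticCurves.ModularForms Literature.NumberTheory.GaloisRepresentations
  Literature.NumberTheory.EllipticCurves.Kato2004 Literature.NumberTheory.EllipticCurves.Kato2004.EulerSystemValues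
  ZpExtension

namespace Literature.NumberTheory.EllipticCurves.Kobayashi2003

/-! ## §1 The hypothesis structure: Thm. 6.2 (6.13)/(6.14) + Thm. 6.3 + Thm. 7.3 i) (7.21) at `η = 1`,
with Kato's Thm. 12.6 zeta submodule, relative to the pinned `𝐇¹_Γ(T_pW)`, `X^ε(E/ℚ_∞)`, `X₀(E/ℚ_∞)` -/

/-- **Kobayashi's Coleman / Poitou–Tate data for the sign `ε` at the trivial character, with Kato's
zeta submodule, on pinned objects** (hypothesis structure; nothing asserted by it — existence is the
named fact `thm62_63_73_signedColemanKato_zeta`). Parameters: a globally minimal elliptic `W/ℚ`, an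
odd good supersingular prime `p` with `a_p = 0` (hypotheses of the fact, not of the structure), a
newform `f` of `W`, the period ratio `ϖ` (`ϖ·Ω_E = Ω⁺_f`), the cyclotomic `(κ, γ)`, a sign `ε`
(`1` = even/plus, `−1` = odd/minus) and Kato's pinned `I : Kato2004.IwasawaH1Data W p κ γ`
(`I.H = 𝐇¹_Γ(T_pW) = 𝐇¹(T)^Δ`). Fields: an INJECTIVE `Λ`-linear `col : 𝐇¹ → Λ` («`Col^ε ∘ loc_p`
through (6.13)/(6.14) on the `Δ`-trivial component»; injective = Thm. 7.3 i)); Kato's zeta submodule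
`Z ≤ 𝐇¹` bounded above by the span of GENUINE `Λ`-adic Euler-system classes (Kato Thm. 12.6 +
Ex. 13.3, verbatim the span clause of `Kato2004.exists_divisibilityInputs_fineQuotient_zeta`); under
`Irr(E[p])`, Thm. 6.3 read on ideals — `col(Z)` and `(L_p^ε(E, X))` (Néron normalisation:
`ι G₁ = C(ϖ)·ι L`, `L` the tree's sign-`ε` Pollack function of `f`) agree after localisation at every
height-one prime; and (7.21) with the Coleman isomorphism composed in — for EVERY dual datum `D` of
`Sel^ε(E/ℚ_∞)` and EVERY dual datum `Y` of `Sel₀(ℚ_∞, E[p^∞])` some `Λ`-linear `Λ → X^ε → X₀` make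
`𝐇¹ →^{col} Λ → X^ε → X₀ → 0` exact (arrows existential). Module docstring: field-by-field locators
and the reading flags `Kob03-eta1-Ftower`, `Kob03-63-eta1-ideal-localized`,
`Kob03-721-eta1-maps-existential`.
[cite: Kobayashi2003, Thm. 6.2 (6.13)–(6.14) and Thm. 6.3 (p. 11), Thm. 7.3 i) (7.21) and proof of Thm. 7.4 (p. 13), Thm. 5.2 iv) and Remark 5.3 i) (pp. 9–10), Def. 2.1 (p. 5), Thm. 3.2 and (3.4)–(3.6) (p. 7)]
[cite: Kato2004Asterisque, Thm. 12.6 (p. 222), Ex. 13.3 (p. 225), §12.2 (p. 220) and §17.13 (p. 280)] -/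
structure SignedColemanKatoData (W : WeierstrassCurve ℚ) [W.IsElliptic] (p : ℕ) [Fact p.Prime]
    [ContinuousSMul ℤ_[p] (W.tateModule p)] [Module.Free ℤ_[p] (W.tateModule p)]
    [Module.Finite ℤ_[p] (W.tateModule p)] {N : ℕ} (f : CuspForm (Gamma0 N) 2) (ϖ : ℚ)
    (κ : ZpExtension ℚ p) (γ : absoluteGaloisGroup ℚ) (ε : ℤˣ)
    (I : Kato2004.IwasawaH1Data W p κ γ) where
  /-- «`Col^ε ∘ loc_p`» on the `Δ`-trivial component: the first arrow of (7.21) (sign `ε`) composed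
  with the isomorphism (6.13) (`ε = 1`) resp. (6.14) (`ε = −1`) onto `Λ^Δ = ℤ_p[[X]]`. -/
  col : I.H →ₗ[IwasawaAlgebra p] IwasawaAlgebra p
  /-- Thm. 7.3 i): `𝐇¹(T) → H¹_Iw(T)/H¹_{Iw,ε}(T)` is injective. -/
  col_injective : Function.Injective col
  /-- Kato Thm. 12.6: the `Λ`-span `Z ⊂ 𝐇¹(T)` of the `p`-power lines of the integral zeta elements
  (8.1.3)/(8.11), projected to the `Δ`-trivial component `𝐇¹_Γ(T_pW)`. -/
  Z : Submodule (IwasawaAlgebra p) I.H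
  /-- Kato Thm. 12.6 with Ex. 13.3: every generator of `Z` is the `Λ`-adic class of a GENUINE integral
  Euler system (`Kato2004.IsEulerSystemClass`), so `Z` lies in the span of such classes — verbatim the
  span clause of `Kato2004.exists_divisibilityInputs_fineQuotient_zeta`. -/
  zeta_le_span : Z ≤ Submodule.span (IwasawaAlgebra p) {s : I.H | Kato2004.IsEulerSystemClass W p κ γ I s}
  /-- Thm. 6.3 (sign `ε`, `η = 1`) with Thm. 5.2 iv) / Remark 5.3 i) and Kato Thm. 12.6 (finite index),
  read on IDEALS at every height-one prime: for the sign-`ε` Pollack function `L` of `f` (tree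
  normalisation `Ω⁺_f`) and `G₁ ∈ Λ` with `ι G₁ = C(ϖ)·ι L` (Kobayashi's Néron-normalised
  `L_p^ε(E, X)`), the ideals `col(Z)` and `(G₁)` of `Λ` agree after localisation at `𝔭`: some `s ∉ 𝔭`
  multiplies each into the other. -/
  image_zeta_localized : W.HasIrreducibleModPGaloisRep p →
    ∀ (L G₁ : IwasawaAlgebra p), IsSignedPAdicLFunction f p ε L →
      iwasawaToPowerSeries p G₁ = PowerSeries.C ((ϖ : ℚ) : ℚ_[p]) * iwasawaToPowerSeries p L →
      ∀ 𝔭 : PrimeSpectrum (IwasawaAlgebra p), 𝔭.asIdeal.height = 1 →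
        ∃ s : IwasawaAlgebra p, s ∉ 𝔭.asIdeal ∧
          s * G₁ ∈ Submodule.map col Z ∧
          ∀ z ∈ Z, s * col z ∈ Ideal.span {G₁}
  /-- (7.21), sign `ε`, `Δ`-trivial component, with (6.13)/(6.14) composed in: for every dual datum
  `D` of `Sel^ε(E/ℚ_∞)` and every dual datum `Y` of `Sel₀(ℚ_∞, E[p^∞])`,
  `𝐇¹ →^{col} Λ → X^ε → X₀ → 0` is exact for SOME `Λ`-linear `Λ → X^ε`, `X^ε → X₀`. -/
  exact : ∀ (D : SignedSelmerDualData W κ γ ε) (Y : W.FineSelmerDualData κ γ),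
    ∃ (j : IwasawaAlgebra p →ₗ[IwasawaAlgebra p] D.X) (k : D.X →ₗ[IwasawaAlgebra p] Y.X),
      Function.Exact col j ∧ Function.Exact j k ∧ Function.Surjective k

/-! ## §2 The named fact: the structure is inhabited (Thm. 6.2 + 6.3 + 7.3 i) at `η = 1`, with
Thm. 5.1 iii) / 5.2 iv) / Remark 5.3 i) and Kato Thm. 12.6 / Ex. 13.3) -/

/-- **Kobayashi 2003, Thm. 6.2 (6.13)/(6.14) + Thm. 6.3 + Thm. 7.3 i) (7.21) at the trivial character
(`F_∞ = ℚ_∞`, the `Δ`-trivial component), together with Kato 2004 Thm. 12.6 / Ex. 13.3, on pinned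
objects.** For every elliptic curve `E/ℚ` with globally minimal model `W` (structure facts of `T_pW`
as instance BINDERS, as in `Kato2004.exists_divisibilityInputs_fineQuotient_zeta`), every ODD prime
`p` of good reduction with `a_p = 0` (hence supersingular: the standing hypotheses of pp. 1–2 and §4),
every newform `f` of `W` with period ratio `ϖ` (`ϖ·Ω_E = Ω⁺_f`), the cyclotomic `ℤ_p`-extension
`κ` with topological generator `γ` matching the cyclotomic variable, every sign `ε` and every pinned
`I : Kato2004.IwasawaH1Data W p κ γ` (`𝐇¹(T)^Δ`): `SignedColemanKatoData W p f ϖ κ γ ε I` is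
inhabited — by `Col^ε ∘ loc_p` composed with (6.13)/(6.14) (injective: Thm. 7.3 i), printed from
Thm. 5.1 iii) — Remark 5.3 i) —, Thm. 6.3 and Rohrlich), Kato's Thm. 12.6 submodule `Z` (inside the
span of genuine Euler-system classes, Ex. 13.3; inside `𝐇¹(T)` and of finite index in `Z(T)` by
Thm. 5.2 iv) for supersingular `p`), the Thm. 6.3 identity `Col^ε(z₊)^Δ = L_p^ε(E, X)` (NÉRON
normalisation: `ι G₁ = C(ϖ)·ι L` with `L` the tree's sign-`ε` Pollack function of `f`) read on ideals
localized at each height-one prime, and the `Δ`-trivial component of (7.21)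
`0 → 𝐇¹(T) → H¹_Iw(T)/H¹_{Iw,ε}(T) ≃ Λ → X^ε(E/K_∞) → X⁰(E/K_∞) → 0` for every dual datum of
`Sel^ε(E/ℚ_∞)` (Def. 1.1) and of `Sel₀(ℚ_∞, E[p^∞])` (Def. 2.1's `Sel⁰`). A CONSTRUCTION fact
(weaker than print: the identity of `col`, `j`, `k` is forgotten up to the listed properties; `Z`
only bounded above by the span), never stronger; nothing asserted; no `_holds` expected soon (Honda
theory §8, Kato §§8–13 and §16, Poitou–Tate along the tower: none in Mathlib; size XL). READING
FLAGS (module docstring): `Kob03-eta1-Ftower`, `Kob03-63-eta1-ideal-localized`,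
`Kob03-721-eta1-maps-existential`. Consumer (kernel, Summits-side, seat `bsd-ssimc-k3-c4x`):
«`μ(L_p^ε(E)) = 0 ⟹ μ(X^ε(E/ℚ_∞)) = 0`» at NON-surjective image (the `±` twin of
`X10.mu_eq_zero_of_fine` / `MultMu.mu_eq_zero_of_multFine`), hence the registered stub
`stub_saturationSmallImage` of crux 4 of route `SignedLowerHalves` (item stmt-BirchSwinnertonDyer-19002)
modulo published facts and the analytic rider.
[cite: Kobayashi2003, Thm. 6.2 (6.13)–(6.14) and Thm. 6.3 (p. 11), Thm. 7.3 i) (7.21), Cor. 7.2 and proof of Thm. 7.4 (p. 13), (7.17)–(7.20) and Prop. 7.1 (p. 12), Thm. 5.1 iii), Thm. 5.2 i)/iv) and Remark 5.3 i) (pp. 9–10), Def. 6.1 (p. 10), Def. 1.1 (p. 2), Def. 2.1 (p. 5), Thm. 3.2 and (3.4)–(3.6) (p. 7), §3 (p. 5), §4 (p. 8)]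
[cite: Kato2004Asterisque, Thm. 12.5 (4) and Thm. 12.6 (p. 222), Ex. 13.3 (p. 225), §12.2 (p. 220), §13.8 (p. 228)]
[cite: GreenbergVatsal2000, §3 (Néron vs canonical period, as used in Kobayashi's proof of Thm. 5.2 iv))] -/
def thm62_63_73_signedColemanKato_zeta : Prop :=
  ∀ (W : WeierstrassCurve ℚ) [W.IsElliptic] [W.IsGloballyMinimal] (p : ℕ) [Fact p.Prime]
    [ContinuousSMul ℤ_[p] (W.tateModule p)] [Module.Free ℤ_[p] (W.tateModule p)]
    [Module.Finite ℤ_[p] (W.tateModule p)] {N : ℕ} [NeZero N] (f : CuspForm (Gamma0 N) 2) (ϖ : ℚ)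
    (κ : ZpExtension ℚ p) (γ : absoluteGaloisGroup ℚ),
    p ≠ 2 → W.HasGoodReductionAtPrime p → W.frobeniusTrace p = 0 → IsNewformOf W f →
    (ϖ : ℝ) * W.realPeriodRat = plusPeriod f →
    κ.IsCyclotomic → κ.IsTopGenerator γ → IsCyclotomicVariable p γ →
    ∀ (ε : ℤˣ) (I : Kato2004.IwasawaH1Data W p κ γ),
      Nonempty (SignedColemanKatoData W p f ϖ κ γ ε I)

end Literature.NumberTheory.EllipticCurves.Kobayashi2003

end
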